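import Literature.AlgebraicGeometry.Resolution.EChartStandardEtale
import Literature.AlgebraicGeometry.Resolution.KaplanskyUnitForms
import Literature.AlgebraicGeometry.Resolution.RoofInField
import Literature.AlgebraicGeometry.Resolution.EtaleChartNormal
import Mathlib.RingTheory.Polynomial.IsIntegral
import HarnessLib

/-!
# The `m`-side étale chart of a henselian-generated point (E-chart)

Topic: `Literature/AlgebraicGeometry/Resolution` (valued function fields). The `m°`-half of the
common smooth roof in the algebraic proof of M. Temkin, *Inseparable local uniformization*,
J. Algebra 373 (2013) = arXiv:0804.1554v3, Thm. 3.3.1 (tree: `Temkin2013RelativeCurveSmoothFibre`).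
Setting, inside one valued field `(Ω, V)`: a constant field `m ≤ Ω` with integers
`m° = O_V ∩ m`, an element `x` (the henselian generator of the valued function field `F` over
`m`: `F ⊆ m(x)^h`, Knaf–Kuhlmann 2009 Thm. 3.8 / Temkin Thm. 3.2.3), a DEEP CENTRE `a₀ ∈ m`
with scaling constant `c₀ ∈ m`, `|x − a₀| ≤ |c₀|`, the chart coordinate `x′ = (x − a₀)/c₀`, and
the local-étale description of `O_F` over `O_{m(x)}` (a Hensel root `η`, standard-étale data
`f, g, h, p₂, s`, and normal forms `z = a_z(η)/(b_z(η) g(η)ᵏ)`; Knaf–Kuhlmann 2009 Lemma 3.7,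
tree: `exists_standardEtale_data_of_henselRoot`). "Deep" means: the finitely many DENOMINATORS
through which the coefficients of these data are expressed admit Kaplansky unit forms at
`(a₀, c₀)` (`KaplanskyUnitForms.lean`), whose product `u ∈ m°[x′]` is a `V`-unit; the
coefficients are then required to lie in the polynomial chart `B = m°[x′][1/u]` (for numerators
this is the Gauss bound on the disc, automatic for functions bounded by `1` on it). The
standard-étale chart
`A = B[η]_{g(η)}` over it is realized inside `O_V` (`EChartStandardEtale.lean`), and the wanted
elements `z` lie in one localization `T = A[1/d]`: an `m°`-subalgebra of `O_V`, SMOOTH over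
`m°` (polynomial ring → localization → étale → localization), containing `x′`, `η` and the `z`'s,
every element of which is a polynomial in `x′, η` over `m°` divided by a power of one `V`-unit.

* `eval_mem_adjoin_of_coeff_mem`, `smooth_adjoin_of_transcendental` — bookkeeping — PROVED;
* `exists_EChart` — **the E-chart** — PROVED.

All statements are [folklore] given the cited results; no definitions, no named facts.

## Sources

* M. Temkin, arXiv:0804.1554v3, proof of Thm. 3.3.1, Steps 2–4 (pp. 44–45) (what is being
  algebraized: "`Y → Spec(m°)` is smooth at `y`").
* H. Knaf, F.-V. Kuhlmann, Adv. Math. 221 (2009), Lemma 3.7 and Thm. 3.8 (local-étale form).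
* F.-V. Kuhlmann, I. Vlahu, Math. Z. 276 (2014), Cor. 7.1 (unit forms), through the tree.
-/

noncomputable section

open Polynomial

namespace Literature.AlgebraicGeometry.Resolution

universe u

variable {Ω : Type u} [Field Ω]

/-! ### Bookkeeping -/

/-- A polynomial over `Ω` whose coefficients are images of elements of `R` evaluates, at an element
of an `R`-subalgebra, into the subalgebra. [folklore] -/
theorem eval_mem_subalgebra_of_coeff_mem {R : Type u} [CommRing R] [Algebra R Ω]
    (S : Subalgebra R Ω) {q : Polynomial Ω} (hq : ∀ i, q.coeff i ∈ S) {z : Ω} (hz : z ∈ S) :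
    q.eval z ∈ S := by
  rw [Polynomial.eval_eq_sum_range]
  exact S.sum_mem fun i _ => S.mul_mem (hq i) (S.pow_mem hz i)

/-- `R[x′] ⊆ Ω` is smooth over `R` for `x′` transcendental over `R`. [folklore] -/
theorem smooth_adjoin_of_transcendental {R : Type u} [CommRing R] [Algebra R Ω] {x' : Ω}
    (htr : Transcendental R x') : Algebra.Smooth R (Algebra.adjoin R ({x'} : Set Ω)) := by
  haveI : Algebra.Smooth R R[X] := ⟨inferInstance, inferInstance⟩
  exact Algebra.Smooth.of_equiv (Polynomial.algEquivOfTranscendental R x' htr)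

/-- `B[1/f]` is an integrally closed domain if `B ⊆ Ω` is. [folklore] -/
theorem isIntegrallyClosed_locAway {R : Type u} [CommRing R] [Algebra R Ω] {B : Subalgebra R Ω}
    {f : Ω} {hf : f ∈ B} (hf0 : f ≠ 0) [IsIntegrallyClosed B] :
    IsIntegrallyClosed (locAway B f hf) := by
  letI := (Subalgebra.inclusion (le_locAway (B := B) (f := f) (hf := hf))).toRingHom.toAlgebra
  haveI := isLocalization_locAway (B := B) (hf := hf) hf0
  refine isIntegrallyClosed_of_isLocalization (locAway B f hf) (Submonoid.powers (⟨f, hf⟩ : B))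
    (fun w hw => ?_)
  obtain ⟨n, rfl⟩ := (Submonoid.mem_powers_iff _ _).mp hw
  exact mem_nonZeroDivisors_of_ne_zero (pow_ne_zero n fun h0 => hf0 (congrArg Subtype.val h0))

/-! ### The E-chart -/

section EChart

variable (V : ValuationSubring Ω) (m : Subfield Ω)

/-- **The E-chart.** See the module docstring. Data: the centre `a₀, c₀ ∈ m` (`c₀ ≠ 0`,
`|x − a₀| ≤ |c₀|`), `x′ = (x − a₀)/c₀` transcendental over `m° = O_V ∩ m`; a finite set `Ps` of
polynomials over `m`, non-vanishing at `x`, each with a unit form at `(a₀, c₀)` (`hU`);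
standard-étale data `η, f, g, h, p₂, s` whose coefficients are `0` or quotients `P(x)/Q(x)`,
`P, Q ∈ Ps`, lying in `O_V` (`hcoef`), with `f` monic of least degree among the non-zero
polynomials over `m(x)` vanishing at `η` (`hfmin`), `f′h + f p₂ = gˢ`, `|g(η)| = 1`; and a finite
set `Z` of elements with normal forms `a_z(η)/(b_z(η) g(η)ᵏ)` of the same kind, `|b_z(η)| = 1`
(`hZ`). Conclusion: an `m°`-subalgebra `T ⊆ O_V`, smooth over `m°`, an integrally closed domain,
containing `x′`, `η` and `Z`,
together with a `V`-unit `D ∈ m°[x′, η] (⊆ T)` such that every element of `T` times a power of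
`D` is a polynomial expression in `x′, η` over `m°`. [folklore] -/
theorem exists_EChart {x a₀ c₀ : Ω} (hxaV : V.valuation (x - a₀) ≤ V.valuation c₀)
    (htr : Transcendental (V.toSubring ⊓ m.toSubring : Subring Ω) ((x - a₀) / c₀))
    {u : Ω} (hu : u ∈ Algebra.adjoin (V.toSubring ⊓ m.toSubring : Subring Ω) ({(x - a₀) / c₀} : Set Ω))
    (hvu : V.valuation u = 1)
    {η : Ω} (hηV : η ∈ V) (f g h p₂ : Polynomial Ω) (s : ℕ) (hfmon : f.Monic) (hfη : f.eval η = 0)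
    (hcoef : ∀ Q ∈ ({f, g, h, p₂} : Set (Polynomial Ω)), ∀ k,
      Q.coeff k ∈ locAway (Algebra.adjoin (V.toSubring ⊓ m.toSubring : Subring Ω)
        ({(x - a₀) / c₀} : Set Ω)) u hu)
    (hfmin : ∀ Q : Polynomial Ω, (∀ k, Q.coeff k ∈ Subfield.closure ((m : Set Ω) ∪ {x})) → Q ≠ 0 →
      Q.eval η = 0 → f.natDegree ≤ Q.natDegree)
    (hident : derivative f * h + f * p₂ = g ^ s) (hvg : V.valuation (g.eval η) = 1)
    (ha₀ : a₀ ∈ m) (hc₀ : c₀ ∈ m)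
    (Z : Finset Ω) (hZ : ∀ z ∈ Z, ∃ (az bz : Polynomial Ω) (k : ℕ),
      (∀ j, az.coeff j ∈ locAway (Algebra.adjoin (V.toSubring ⊓ m.toSubring : Subring Ω)
          ({(x - a₀) / c₀} : Set Ω)) u hu ∧
        bz.coeff j ∈ locAway (Algebra.adjoin (V.toSubring ⊓ m.toSubring : Subring Ω)
          ({(x - a₀) / c₀} : Set Ω)) u hu) ∧
      V.valuation (bz.eval η) = 1 ∧ z = az.eval η / (bz.eval η * g.eval η ^ k)) :
    ∃ (T : Subalgebra (V.toSubring ⊓ m.toSubring : Subring Ω) Ω),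
      Algebra.Smooth (V.toSubring ⊓ m.toSubring : Subring Ω) T ∧ IsIntegrallyClosed T ∧
      T.toSubring ≤ V.toSubring ∧ (x - a₀) / c₀ ∈ T ∧ η ∈ T ∧ (∀ z ∈ Z, z ∈ T) ∧
      ∃ D ∈ Algebra.adjoin (V.toSubring ⊓ m.toSubring : Subring Ω) ({(x - a₀) / c₀, η} : Set Ω),
        V.valuation D = 1 ∧ ∀ w ∈ T, ∃ N : ℕ,
        w * D ^ N ∈ Algebra.adjoin (V.toSubring ⊓ m.toSubring : Subring Ω) ({(x - a₀) / c₀, η} : Set Ω) := by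
  classical
  set Om : Subring Ω := V.toSubring ⊓ m.toSubring with hOm
  set x' : Ω := (x - a₀) / c₀ with hx'
  have hmemOm : ∀ z : Ω, z ∈ Om ↔ z ∈ V ∧ z ∈ m := fun z => Subring.mem_inf
  have hx'V : x' ∈ V := by
    rw [← V.valuation_le_one_iff, hx', map_div₀]
    exact div_le_one_of_le₀ hxaV zero_le
  -- the polynomial chart `B₀ = m°[x′]`
  set B₀ : Subalgebra Om Ω := Algebra.adjoin Om ({x'} : Set Ω) with hB₀
  haveI hsmB₀ : Algebra.Smooth Om B₀ := smooth_adjoin_of_transcendental htr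
  haveI : IsIntegrallyClosed Om := isIntegrallyClosed_inf V m
  haveI hicB₀ : IsIntegrallyClosed B₀ :=
    IsIntegrallyClosed.of_equiv (Polynomial.algEquivOfTranscendental Om x' htr).toRingEquiv
  have hx'B₀ : x' ∈ B₀ := Algebra.subset_adjoin rfl
  have hOmB₀ : ∀ z : Ω, z ∈ V → z ∈ m → z ∈ B₀ := fun z hzV hzm =>
    B₀.algebraMap_mem ⟨z, (hmemOm z).mpr ⟨hzV, hzm⟩⟩
  -- `m° ⊆ V` as an `Om`-subalgebra, and `B₀ ⊆ V`
  let VOm : Subalgebra Om Ω :=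
    { V.toSubring with
      algebraMap_mem' := fun c => ((hmemOm c).mp c.2).1 }
  have hB₀VOm : B₀ ≤ VOm := Algebra.adjoin_le (Set.singleton_subset_iff.mpr hx'V)
  have hB₀V : B₀.toSubring ≤ V.toSubring := fun z hz => hB₀VOm hz
  -- `B₀ ⊆ E = m(x)`
  set E : Subfield Ω := Subfield.closure ((m : Set Ω) ∪ {x}) with hE
  have hmE : ∀ z ∈ m, z ∈ E := fun z hz => Subfield.subset_closure (Or.inl hz)
  have hxE : x ∈ E := Subfield.subset_closure (Or.inr rfl)
  have hx'E : x' ∈ E := E.div_mem (E.sub_mem hxE (hmE _ ha₀)) (hmE _ hc₀)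
  let EOm : Subalgebra Om Ω :=
    { E.toSubring with
      algebraMap_mem' := fun c => hmE _ ((hmemOm c).mp c.2).2 }
  have hB₀E : B₀ ≤ EOm := Algebra.adjoin_le (Set.singleton_subset_iff.mpr hx'E)
  -- the chart `B = B₀[1/u]`
  have huB₀ : u ∈ B₀ := hu
  have hu0 : u ≠ 0 := fun h0 => by rw [h0, map_zero] at hvu; exact zero_ne_one hvu
  set B : Subalgebra Om Ω := locAway B₀ u huB₀ with hBdef
  haveI hsmB : Algebra.Smooth Om B := smooth_locAway_of_smooth hu0
  haveI hicB : IsIntegrallyClosed B := isIntegrallyClosed_locAway hu0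
  have hBV : B.toSubring ≤ V.toSubring := locAway_le_valuationSubring hB₀V hvu
  have hB₀B : B₀ ≤ B := le_locAway
  have hBE : ∀ w ∈ B, w ∈ E := fun w hw =>
    locAway_subset_subfield (E := E) (fun z hz => hB₀E hz) hu0 hw
  have hmemB : ∀ q : Ω, q ∈ locAway (Algebra.adjoin Om ({x'} : Set Ω)) u hu → q ∈ B := fun q hq => hq
  -- lifting the standard-étale data to `B`
  have hRV : ∀ r : B, algebraMap B Ω r ∈ V := fun r => hBV r.2
  have hBinj : Function.Injective (algebraMap B Ω) := Subtype.val_injective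
  have hlift : ∀ Q ∈ ({f, g, h, p₂} : Set (Polynomial Ω)), Q ∈ Polynomial.lifts (algebraMap B Ω) := by
    intro Q hQ
    refine (Polynomial.lifts_iff_coeff_lifts _).mpr fun k => ?_
    exact ⟨⟨Q.coeff k, hmemB _ (hcoef Q hQ k)⟩, rfl⟩
  obtain ⟨fB, hfB, -, hfBmon⟩ := Polynomial.lifts_and_degree_eq_and_monic
    (hlift f (by simp)) hfmon
  obtain ⟨gB, hgB⟩ := (Polynomial.mem_lifts _).mp (hlift g (by simp))
  obtain ⟨hB, hhB⟩ := (Polynomial.mem_lifts _).mp (hlift h (by simp))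
  obtain ⟨p₂B, hp₂B⟩ := (Polynomial.mem_lifts _).mp (hlift p₂ (by simp))
  have haeval : ∀ q : Polynomial B, Polynomial.aeval η q = (q.map (algebraMap B Ω)).eval η :=
    fun q => by rw [Polynomial.eval_map, Polynomial.aeval_def]
  have hfBη : Polynomial.aeval η fB = 0 := by rw [haeval, hfB, hfη]
  have hfBmin : ∀ q : Polynomial B, q ≠ 0 → Polynomial.aeval η q = 0 →
      fB.natDegree ≤ q.natDegree := by
    intro q hq0 hqη
    have h1 := hfmin (q.map (algebraMap B Ω)) (fun k => by
      rw [Polynomial.coeff_map]; exact hBE _ (q.coeff k).2)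
      ((Polynomial.map_ne_zero_iff hBinj).mpr hq0) (by rw [← haeval]; exact hqη)
    rwa [← hfB, Polynomial.natDegree_map_eq_of_injective hBinj,
      Polynomial.natDegree_map_eq_of_injective hBinj] at h1
  have hidentB : derivative fB * hB + fB * p₂B = gB ^ s := by
    apply Polynomial.map_injective (algebraMap B Ω) hBinj
    rw [Polynomial.map_add, Polynomial.map_mul, Polynomial.map_mul, ← Polynomial.derivative_map,
      Polynomial.map_pow, hfB, hgB, hhB, hp₂B, hident]
  have hvgB : V.valuation (Polynomial.aeval η gB) = 1 := by rw [haeval, hgB, hvg]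
  obtain ⟨A, hAV, hetA, hpolyA, hginvA, hnf⟩ :=
    exists_standardEtale_chart V hRV hηV fB gB hB p₂B s hfBmon hfBη hfBmin hidentB hvgB
  have hgBη : Polynomial.aeval η gB = g.eval η := by rw [haeval, hgB]
  rw [hgBη] at hginvA hnf
  have hgη0 : g.eval η ≠ 0 := fun h0 => by rw [h0, map_zero] at hvg; exact zero_ne_one hvg
  -- basic members of `A`
  have hBA : ∀ w ∈ B, w ∈ A := fun w hw => A.algebraMap_mem ⟨w, hw⟩
  have hηA : η ∈ A := by
    have := hpolyA Polynomial.X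
    rwa [Polynomial.aeval_X] at this
  have hx'A : x' ∈ A := hBA _ (hB₀B hx'B₀)
  have hevalA : ∀ Q : Polynomial Ω, (∀ j, Q.coeff j ∈ B) → Q.eval η ∈ A := fun Q hQ =>
    eval_mem_subalgebra_of_coeff_mem A (fun j => hBA _ (hQ j)) hηA
  -- the denominators of the `z ∈ Z`
  choose az bz kz hcz hvbz hzeq using fun z : Z => hZ z.1 z.2
  have hazB : ∀ (z : Z) (j : ℕ), (az z).coeff j ∈ B := fun z j => hmemB _ (hcz z j).1
  have hbzB : ∀ (z : Z) (j : ℕ), (bz z).coeff j ∈ B := fun z j => hmemB _ (hcz z j).2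
  have hbz0 : ∀ z : Z, (bz z).eval η ≠ 0 := fun z h0 => by
    have := hvbz z; rw [h0, map_zero] at this; exact zero_ne_one this
  set d : Ω := ∏ z ∈ (Finset.univ : Finset Z), (bz z).eval η with hd
  have hdA : d ∈ A := A.prod_mem fun z _ => hevalA _ (hbzB z)
  have hvd : V.valuation d = 1 := by
    rw [hd, map_prod]; exact Finset.prod_eq_one fun z _ => hvbz z
  have hd0 : d ≠ 0 := fun h0 => by rw [h0, map_zero] at hvd; exact zero_ne_one hvd
  -- the chart `T = A[1/d]`
  haveI : Algebra.FormallyEtale B A := hetA.formallyEtale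
  haveI : Algebra.FinitePresentation B A := hetA.finitePresentation
  haveI hsmA : Algebra.Smooth B A := ⟨inferInstance, inferInstance⟩
  haveI : Algebra.Etale B A := hetA
  haveI hicA : IsIntegrallyClosed A :=
    isIntegrallyClosed_of_etale (R := B) (T := A) fun a b hab => Subtype.ext (by
      have := congrArg (fun w : A => (w : Ω)) hab
      exact this)
  set T' : Subalgebra B Ω := locAway A d hdA with hT'
  have hsmT' : Algebra.Smooth B T' := smooth_locAway_of_smooth hd0
  have hicT' : IsIntegrallyClosed T' := isIntegrallyClosed_locAway hd0
  have hT'V : T'.toSubring ≤ V.toSubring := locAway_le_valuationSubring hAV hvd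
  have hAT' : A ≤ T' := le_locAway
  have hdinvT' : d⁻¹ ∈ T' := inv_mem_locAway hd0
  have hbzinvT' : ∀ z : Z, ((bz z).eval η)⁻¹ ∈ T' := by
    intro z
    have h1 : (bz z).eval η * ∏ w ∈ (Finset.univ : Finset Z).erase z, (bz w).eval η = d := by
      rw [hd]
      exact Finset.mul_prod_erase (Finset.univ : Finset Z) (fun w : Z => (bz w).eval η)
        (Finset.mem_univ z)
    have h2 : ((bz z).eval η)⁻¹ = (∏ w ∈ (Finset.univ : Finset Z).erase z, (bz w).eval η) * d⁻¹ := by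
      rw [eq_mul_inv_iff_mul_eq₀ hd0, ← h1, ← mul_assoc, inv_mul_cancel₀ (hbz0 z), one_mul]
    rw [h2]
    exact T'.mul_mem (hAT' (A.prod_mem fun w _ => hevalA _ (hbzB w))) hdinvT'
  have hzT' : ∀ z : Z, (z : Ω) ∈ T' := by
    intro z
    rw [hzeq z, div_eq_mul_inv, mul_inv, ← inv_pow]
    exact T'.mul_mem (hAT' (hevalA _ (hazB z)))
      (T'.mul_mem (hbzinvT' z) (T'.pow_mem (hAT' hginvA) _))
  -- `T` as an `m°`-algebra: smooth by composition
  have hsmOmT' : Algebra.Smooth Om T' := by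
    haveI := hsmT'
    exact Algebra.Smooth.comp Om B T'
  set T : Subalgebra Om Ω := T'.restrictScalars Om with hTdef
  have hsmT : Algebra.Smooth Om T := hsmOmT'
  have hicT : IsIntegrallyClosed T := hicT'
  have hmemT : ∀ w : Ω, w ∈ T ↔ w ∈ T' := fun w => Iff.rfl
  -- the normal-form export: everything is a polynomial in `x′, η` over `m°` up to powers of one unit
  set S : Subalgebra Om Ω := Algebra.adjoin Om ({x', η} : Set Ω) with hS
  have hB₀S : B₀ ≤ S := Algebra.adjoin_mono (Set.singleton_subset_iff.mpr (Set.mem_insert _ _))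
  have hηS : η ∈ S := Algebra.subset_adjoin (Set.mem_insert_of_mem _ rfl)
  have huS : u ∈ S := hB₀S huB₀
  have hcoefpow : ∀ c ∈ B, ∃ k : ℕ, c * u ^ k ∈ S := fun c hc => by
    obtain ⟨k, hk⟩ := (mem_locAway_iff (hf := huB₀)).mp hc
    exact ⟨k, hB₀S hk⟩
  have hpow : ∀ Q : Polynomial Ω, (∀ j, Q.coeff j ∈ B) → ∃ K : ℕ, u ^ K * Q.eval η ∈ S := by
    intro Q hQ
    choose kf hkf using fun j => hcoefpow _ (hQ j)
    refine ⟨∑ j ∈ Finset.range (Q.natDegree + 1), kf j, ?_⟩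
    rw [Polynomial.eval_eq_sum_range, Finset.mul_sum]
    refine S.sum_mem fun j hj => ?_
    have hsplit : (∑ i ∈ Finset.range (Q.natDegree + 1), kf i) =
        kf j + ∑ i ∈ (Finset.range (Q.natDegree + 1)).erase j, kf i :=
      (Finset.add_sum_erase _ _ hj).symm
    rw [hsplit, pow_add]
    have : u ^ kf j * u ^ (∑ i ∈ (Finset.range (Q.natDegree + 1)).erase j, kf i) *
        (Q.coeff j * η ^ j) =
        (Q.coeff j * u ^ kf j) * (u ^ (∑ i ∈ (Finset.range (Q.natDegree + 1)).erase j, kf i) * η ^ j) := by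
      ring
    rw [this]
    exact S.mul_mem (hkf j) (S.mul_mem (S.pow_mem huS _) (S.pow_mem hηS _))
  obtain ⟨Kg, hKg⟩ := hpow g (fun j => hmemB _ (hcoef g (by simp) j))
  have hpowd : ∃ Kd : ℕ, u ^ Kd * d ∈ S := by
    choose Kb hKb using fun z : Z => hpow (bz z) (hbzB z)
    refine ⟨∑ z ∈ (Finset.univ : Finset Z), Kb z, ?_⟩
    rw [hd, ← Finset.prod_pow_eq_pow_sum, ← Finset.prod_mul_distrib]
    exact S.prod_mem fun z _ => hKb z
  obtain ⟨Kd, hKd⟩ := hpowd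
  set D : Ω := u * (u ^ Kg * g.eval η) * (u ^ Kd * d) with hD
  have hDS : D ∈ S := S.mul_mem (S.mul_mem huS hKg) hKd
  have hvD : V.valuation D = 1 := by
    rw [hD, map_mul, map_mul, map_mul, map_mul, map_pow, map_pow, hvu, hvg, hvd]
    simp
  have hD0 : D ≠ 0 := fun h0 => by rw [h0, map_zero] at hvD; exact zero_ne_one hvD
  -- `G = S[1/D]` contains `T`
  set G : Subalgebra Om Ω := locAway S D hDS with hG
  have hSG : S ≤ G := le_locAway
  have hDinvG : D⁻¹ ∈ G := inv_mem_locAway hD0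
  have hfacinv : ∀ a b : Ω, a * b = D → a ∈ S → b⁻¹ ∈ G := by
    intro a b hab haS
    have hb0 : b ≠ 0 := fun h0 => hD0 (by rw [← hab, h0, mul_zero])
    have h1 : b⁻¹ * D = a := by
      rw [← hab, mul_comm a b, ← mul_assoc, inv_mul_cancel₀ hb0, one_mul]
    have h2 : b⁻¹ = a * D⁻¹ := by rw [eq_mul_inv_iff_mul_eq₀ hD0]; exact h1
    rw [h2]
    exact G.mul_mem (hSG haS) hDinvG
  have huinvG : u⁻¹ ∈ G :=
    hfacinv ((u ^ Kg * g.eval η) * (u ^ Kd * d)) u (by rw [hD]; ring) (S.mul_mem hKg hKd)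
  have hginvG : (g.eval η)⁻¹ ∈ G := by
    have h1 : (u ^ Kg * g.eval η)⁻¹ ∈ G :=
      hfacinv (u * (u ^ Kd * d)) _ (by rw [hD]; ring) (S.mul_mem huS hKd)
    have h2 : (g.eval η)⁻¹ = u ^ Kg * (u ^ Kg * g.eval η)⁻¹ := by
      rw [mul_inv, ← mul_assoc, mul_inv_cancel₀ (pow_ne_zero _ hu0), one_mul]
    rw [h2]
    exact G.mul_mem (hSG (S.pow_mem huS _)) h1
  have hdinvG : d⁻¹ ∈ G := by
    have h1 : (u ^ Kd * d)⁻¹ ∈ G :=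
      hfacinv (u * (u ^ Kg * g.eval η)) _ (by rw [hD]) (S.mul_mem huS hKg)
    have h2 : d⁻¹ = u ^ Kd * (u ^ Kd * d)⁻¹ := by
      rw [mul_inv, ← mul_assoc, mul_inv_cancel₀ (pow_ne_zero _ hu0), one_mul]
    rw [h2]
    exact G.mul_mem (hSG (S.pow_mem huS _)) h1
  have hBG : ∀ w ∈ B, w ∈ G := by
    intro w hw
    obtain ⟨b₀, hb₀, n, rfl⟩ := (mem_locAway_iff_exists_div (hf := huB₀) hu0).mp hw
    rw [div_eq_mul_inv, ← inv_pow]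
    exact G.mul_mem (hSG (hB₀S hb₀)) (G.pow_mem huinvG n)
  have hηG : η ∈ G := hSG hηS
  have hAG : ∀ w ∈ A, w ∈ G := by
    intro w hw
    obtain ⟨q, n, rfl⟩ := hnf w hw
    rw [div_eq_mul_inv, ← inv_pow, haeval]
    refine G.mul_mem (eval_mem_subalgebra_of_coeff_mem G (fun j => ?_) hηG) (G.pow_mem hginvG n)
    rw [Polynomial.coeff_map]
    exact hBG _ (q.coeff j).2
  have hT'G : ∀ w ∈ T', w ∈ G := by
    intro w hw
    obtain ⟨a, ha, n, rfl⟩ := (mem_locAway_iff_exists_div (hf := hdA) hd0).mp hw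
    rw [div_eq_mul_inv, ← inv_pow]
    exact G.mul_mem (hAG a ha) (G.pow_mem hdinvG n)
  -- conclusion
  have hST : S ≤ T := by
    refine Algebra.adjoin_le ?_
    rintro w (rfl | rfl)
    · exact (hmemT _).mpr (hAT' hx'A)
    · exact (hmemT _).mpr (hAT' hηA)
  refine ⟨T, hsmT, hicT, fun w hw => hT'V ((hmemT w).mp hw), (hmemT _).mpr (hAT' hx'A),
    (hmemT _).mpr (hAT' hηA), fun z hz => (hmemT _).mpr (hzT' ⟨z, hz⟩), D, hDS, hvD,
    fun w hw => ?_⟩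
  exact (mem_locAway_iff (hf := hDS)).mp (hT'G w ((hmemT w).mp hw))

end EChart

end Literature.AlgebraicGeometry.Resolution

end
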